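import Literature.AlgebraicGeometry.Pohlmann1968.HodgeClassesCMTypeProducts
import Literature.AlgebraicGeometry.Motives.AbelianVarietyProduct
import HarnessLib

/-!
# BiquadraticSecantLift · route-posited objects for crux X2 `BiquadraticBaseChangeHyperbolic` (stmt-HodgeConjecture-22133)

`<RouteSlug>Defs` file (D-0016) of route-HodgeConjecture-BiquadraticSecantLift: the objects named by crux X2 and used by
its helper files, with their defining identities. Everything is a DEFINITION WITH BODY plus its unfolding / component
lemmas; nothing is asserted about the Hodge conjecture (HC is NOT proved; X2 is not proved by this file).

* `bqPoly d m = S² + 2d(1+m)S + d²(m-1)²` — LITERALLY the route's polynomial `R_(d,m)` (minimal polynomial of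
  `η² = -d(1+√m)²`; `E = ℚ[T]/(R_(d,m)(T²)) = ℚ(√-d, √m)`, `F = ℚ(√m)`).
* `etaBiprod A φ m : A ⊞ A ⟶ A ⊞ A` — LITERALLY the route's endomorphism
  `η_(d,m) = (φ ⊞ φ) ≫ (𝟙 + ψ_m)`, `ψ_m = biprod.lift (m • snd) fst`.
* The working carrier is the FINITE biproduct `twelvefold A = ⨁_{j : Fin 2} A` (on which the tree's Künneth /
  product-polarization / Kähler block lemmas are stated: `Pohlmann1968.sum_map_π_map_ι`,
  `Milne1999.sumPolarizationClass`, `Deligne1982.isKaehlerClass_sum_map_blockProjection`): `phiTwo A φ = φ ⊕ φ`,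
  `psiTwo A m` (`(x, y) ↦ (m y, x)`, `ψ² = m`), `etaTwo A φ m = phiTwo ≫ (𝟙 + psiTwo)`, the swap `swapTwo A`
  (`(x, y) ↦ (y, x)`), the shift `shiftTwo A` (`(x, y) ↦ (y, 0)`), and the comparison isomorphism
  `biprodIsoTwelvefold A : A ⊞ A ≅ twelvefold A` intertwining `etaBiprod` and `etaTwo` (`biprodIsoTwelvefold_hom_etaTwo`).

## References
[cite: Deligne1982HodgeCycles, §4 p. 30 and §5 p. 55 (`B_α = A_α ⊗ E`)] [cite: vanGeemen1994HodgeAV, Lemma 5.2]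
-/

-- every declaration of this problem lives in `Summit.HodgeConjecture.HodgeConjecture.…` (summit = sub-problem)
set_option linter.dupNamespace false

noncomputable section

open CategoryTheory CategoryTheory.Limits Polynomial

namespace Summit.HodgeConjecture.HodgeConjecture.BiquadraticSecantLift

open Literature.AlgebraicGeometry.Motives (AbelianVariety)

/-! ## §1 The polynomial `R_(d,m)` -/

/-- `R_(d,m)(S) = S² + 2d(1+m)·S + d²(m-1)²` — the route's polynomial (minimal polynomial of `η_(d,m)²`). -/
def bqPoly (d m : ℕ) : Polynomial ℤ :=
  X ^ 2 + C (2 * (d : ℤ) * (1 + (m : ℤ))) * X + C ((d : ℤ) ^ 2 * ((m : ℤ) - 1) ^ 2)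

/-- Unfolding `bqPoly` (definitional). -/
theorem bqPoly_eq (d m : ℕ) :
    bqPoly d m = X ^ 2 + C (2 * (d : ℤ) * (1 + (m : ℤ))) * X + C ((d : ℤ) ^ 2 * ((m : ℤ) - 1) ^ 2) := rfl

/-! ## §2 The route's endomorphism `η_(d,m)` of `A ⊞ A` -/

variable (A : AbelianVariety ℂ) (φ : A ⟶ A) (m : ℕ)

/-- `η_(d,m) = (φ ⊞ φ) ≫ (𝟙 + ψ_m)` with `ψ_m = biprod.lift (m • snd) fst` — LITERALLY the endomorphism of `A ⊞ A` in the
route decl `BiquadraticBaseChangeHyperbolic`. -/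
def etaBiprod : A ⊞ A ⟶ A ⊞ A :=
  biprod.map φ φ ≫ (𝟙 (A ⊞ A) + biprod.lift (m • (biprod.snd : A ⊞ A ⟶ A)) biprod.fst)

/-- Unfolding `etaBiprod` (definitional). -/
theorem etaBiprod_eq :
    etaBiprod A φ m = biprod.map φ φ ≫ (𝟙 (A ⊞ A) + biprod.lift (m • (biprod.snd : A ⊞ A ⟶ A)) biprod.fst) := rfl

/-! ## §3 The finite-biproduct carrier `⨁_{Fin 2} A` and its endomorphisms -/

/-- The twelvefold `B = ⨁_{j : Fin 2} A` (for `dim A = 6`), the finite-biproduct form of `A ⊞ A = A ⊗_ℤ ℤ²`. -/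
abbrev twelvefold : AbelianVariety ℂ := ⨁ (fun _ : Fin 2 => A)

/-- `φ ⊕ φ` on `⨁_{Fin 2} A` (the `K = ℚ(φ)`-structure, `√-d ↦ φ ⊕ φ`). -/
def phiTwo : twelvefold A ⟶ twelvefold A := biproduct.map (fun _ : Fin 2 => φ)

/-- `ψ_m : (x, y) ↦ (m·y, x)` on `⨁_{Fin 2} A` (real multiplication by `√m`: `ψ_m² = m`). -/
def psiTwo : twelvefold A ⟶ twelvefold A :=
  biproduct.lift (fun j : Fin 2 => Fin.cases (m • biproduct.π (fun _ : Fin 2 => A) 1)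
    (fun _ => biproduct.π (fun _ : Fin 2 => A) 0) j)

/-- `η = (φ ⊕ φ) ≫ (𝟙 + ψ_m)` on `⨁_{Fin 2} A` (the route's `η_(d,m)` read on the finite biproduct). -/
def etaTwo : twelvefold A ⟶ twelvefold A := phiTwo A φ ≫ (𝟙 (twelvefold A) + psiTwo A m)

/-- The swap `σ : (x, y) ↦ (y, x)` of `⨁_{Fin 2} A` (an involution). -/
def swapTwo : twelvefold A ⟶ twelvefold A :=
  biproduct.lift (fun j : Fin 2 => Fin.cases (biproduct.π (fun _ : Fin 2 => A) 1)
    (fun _ => biproduct.π (fun _ : Fin 2 => A) 0) j)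

/-- The shift `(x, y) ↦ (y, 0)` of `⨁_{Fin 2} A`. -/
def shiftTwo : twelvefold A ⟶ twelvefold A :=
  biproduct.lift (fun j : Fin 2 => Fin.cases (biproduct.π (fun _ : Fin 2 => A) 1) (fun _ => 0) j)

/-! ### Components -/

/-- `(φ ⊕ φ) ≫ πⱼ = πⱼ ≫ φ`. -/
@[simp] theorem phiTwo_π (j : Fin 2) : phiTwo A φ ≫ biproduct.π _ j = biproduct.π _ j ≫ φ := by
  rw [phiTwo, biproduct.map_π]

/-- `ψ_m ≫ π₀ = m · π₁`. -/
@[simp] theorem psiTwo_π_zero : psiTwo A m ≫ biproduct.π _ 0 = m • biproduct.π (fun _ : Fin 2 => A) 1 := by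
  rw [psiTwo, biproduct.lift_π]; rfl

/-- `ψ_m ≫ π₁ = π₀`. -/
@[simp] theorem psiTwo_π_one : psiTwo A m ≫ biproduct.π _ 1 = biproduct.π (fun _ : Fin 2 => A) 0 := by
  rw [psiTwo, biproduct.lift_π]; rfl

/-- `σ ≫ π₀ = π₁`. -/
@[simp] theorem swapTwo_π_zero : swapTwo A ≫ biproduct.π _ 0 = biproduct.π (fun _ : Fin 2 => A) 1 := by
  rw [swapTwo, biproduct.lift_π]; rfl

/-- `σ ≫ π₁ = π₀`. -/
@[simp] theorem swapTwo_π_one : swapTwo A ≫ biproduct.π _ 1 = biproduct.π (fun _ : Fin 2 => A) 0 := by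
  rw [swapTwo, biproduct.lift_π]; rfl

/-- `shift ≫ π₀ = π₁`. -/
@[simp] theorem shiftTwo_π_zero : shiftTwo A ≫ biproduct.π _ 0 = biproduct.π (fun _ : Fin 2 => A) 1 := by
  rw [shiftTwo, biproduct.lift_π]; rfl

/-- `shift ≫ π₁ = 0`. -/
@[simp] theorem shiftTwo_π_one : shiftTwo A ≫ biproduct.π _ 1 = 0 := by
  rw [shiftTwo, biproduct.lift_π]; rfl

/-- A morphism into `⨁_{Fin 2} A` is determined by its two components. -/
theorem twelvefold_hom_ext {X : AbelianVariety ℂ} {f g : X ⟶ twelvefold A}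
    (h0 : f ≫ biproduct.π _ 0 = g ≫ biproduct.π _ 0) (h1 : f ≫ biproduct.π _ 1 = g ≫ biproduct.π _ 1) : f = g := by
  refine biproduct.hom_ext _ _ fun j => ?_
  fin_cases j
  · exact h0
  · exact h1

/-- `ψ_m ≫ ψ_m = m · 𝟙` (`ψ_m` is real multiplication by `√m`). -/
theorem psiTwo_comp_psiTwo : psiTwo A m ≫ psiTwo A m = m • 𝟙 (twelvefold A) := by
  refine twelvefold_hom_ext A ?_ ?_
  · rw [Category.assoc, psiTwo_π_zero, Preadditive.comp_nsmul, psiTwo_π_one, Preadditive.nsmul_comp,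
      Category.id_comp]
  · rw [Category.assoc, psiTwo_π_one, psiTwo_π_zero, Preadditive.nsmul_comp, Category.id_comp]

/-- `(φ ⊕ φ)` commutes with `ψ_m`. -/
theorem phiTwo_comp_psiTwo : phiTwo A φ ≫ psiTwo A m = psiTwo A m ≫ phiTwo A φ := by
  refine twelvefold_hom_ext A ?_ ?_
  · rw [Category.assoc, psiTwo_π_zero, Preadditive.comp_nsmul, phiTwo_π, Category.assoc, phiTwo_π,
      ← Category.assoc, psiTwo_π_zero, Preadditive.nsmul_comp]
  · rw [Category.assoc, psiTwo_π_one, phiTwo_π, Category.assoc, phiTwo_π, ← Category.assoc, psiTwo_π_one]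

/-- `(φ ⊕ φ) ≫ (φ ⊕ φ) = -d · 𝟙` when `φ ≫ φ = -d · 𝟙`. -/
theorem phiTwo_comp_phiTwo {d : ℕ} (hφ : φ ≫ φ = -(d • 𝟙 A)) : phiTwo A φ ≫ phiTwo A φ = -(d • 𝟙 (twelvefold A)) := by
  refine biproduct.hom_ext _ _ fun j => ?_
  rw [Category.assoc, phiTwo_π, ← Category.assoc, phiTwo_π, Category.assoc, hφ, Preadditive.comp_neg,
    Preadditive.neg_comp, Preadditive.comp_nsmul, Preadditive.nsmul_comp, Category.comp_id, Category.id_comp]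

/-- The swap is an involution. -/
theorem swapTwo_comp_swapTwo : swapTwo A ≫ swapTwo A = 𝟙 (twelvefold A) := by
  refine twelvefold_hom_ext A ?_ ?_
  · rw [Category.assoc, swapTwo_π_zero, swapTwo_π_one, Category.id_comp]
  · rw [Category.assoc, swapTwo_π_one, swapTwo_π_zero, Category.id_comp]

/-- `ι₀ ≫ σ = ι₁`. -/
theorem ι_zero_comp_swapTwo : biproduct.ι (fun _ : Fin 2 => A) 0 ≫ swapTwo A = biproduct.ι (fun _ : Fin 2 => A) 1 := by
  refine twelvefold_hom_ext A ?_ ?_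
  · rw [Category.assoc, swapTwo_π_zero, biproduct.ι_π_ne _ (by decide), biproduct.ι_π_ne _ (by decide)]
  · rw [Category.assoc, swapTwo_π_one, biproduct.ι_π_self, biproduct.ι_π_self]

/-- `ι₁ ≫ σ = ι₀`. -/
theorem ι_one_comp_swapTwo : biproduct.ι (fun _ : Fin 2 => A) 1 ≫ swapTwo A = biproduct.ι (fun _ : Fin 2 => A) 0 := by
  refine twelvefold_hom_ext A ?_ ?_
  · rw [Category.assoc, swapTwo_π_zero, biproduct.ι_π_self, biproduct.ι_π_self]
  · rw [Category.assoc, swapTwo_π_one, biproduct.ι_π_ne _ (by decide), biproduct.ι_π_ne _ (by decide)]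

/-! ## §4 The comparison `A ⊞ A ≅ ⨁_{Fin 2} A` -/

/-- The comparison isomorphism `A ⊞ A ≅ ⨁_{j : Fin 2} A` (`(fst, snd) ↦ (π₀, π₁)`). -/
def biprodIsoTwelvefold : A ⊞ A ≅ twelvefold A where
  hom := biproduct.lift (fun j : Fin 2 => Fin.cases (biprod.fst : A ⊞ A ⟶ A) (fun _ => biprod.snd) j)
  inv := biprod.lift (biproduct.π (fun _ : Fin 2 => A) 0) (biproduct.π (fun _ : Fin 2 => A) 1)
  hom_inv_id := by
    refine biprod.hom_ext _ _ ?_ ?_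
    · rw [Category.assoc, biprod.lift_fst, biproduct.lift_π, Category.id_comp]; rfl
    · rw [Category.assoc, biprod.lift_snd, biproduct.lift_π, Category.id_comp]; rfl
  inv_hom_id := by
    refine biproduct.hom_ext _ _ fun j => ?_
    fin_cases j
    · change (_ ≫ _) ≫ biproduct.π _ 0 = 𝟙 _ ≫ biproduct.π _ 0
      rw [Category.assoc, biproduct.lift_π, Category.id_comp]
      exact biprod.lift_fst _ _
    · change (_ ≫ _) ≫ biproduct.π _ 1 = 𝟙 _ ≫ biproduct.π _ 1
      rw [Category.assoc, biproduct.lift_π, Category.id_comp]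
      exact biprod.lift_snd _ _

/-- The comparison followed by `π₀` is `biprod.fst`. -/
@[reassoc (attr := simp)] theorem biprodIsoTwelvefold_hom_π_zero :
    (biprodIsoTwelvefold A).hom ≫ biproduct.π _ 0 = (biprod.fst : A ⊞ A ⟶ A) := by
  change biproduct.lift _ ≫ _ = _
  rw [biproduct.lift_π]; rfl

/-- The comparison followed by `π₁` is `biprod.snd`. -/
@[reassoc (attr := simp)] theorem biprodIsoTwelvefold_hom_π_one :
    (biprodIsoTwelvefold A).hom ≫ biproduct.π _ 1 = (biprod.snd : A ⊞ A ⟶ A) := by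
  change biproduct.lift _ ≫ _ = _
  rw [biproduct.lift_π]; rfl

/-- **The comparison intertwines the route's `η_(d,m)` on `A ⊞ A` with `etaTwo` on `⨁_{Fin 2} A`.** -/
theorem etaBiprod_comp_biprodIsoTwelvefold_hom :
    etaBiprod A φ m ≫ (biprodIsoTwelvefold A).hom = (biprodIsoTwelvefold A).hom ≫ etaTwo A φ m := by
  refine twelvefold_hom_ext A ?_ ?_
  · simp only [Category.assoc, biprodIsoTwelvefold_hom_π_zero, etaTwo, etaBiprod, Preadditive.add_comp,
      Preadditive.comp_add, Category.id_comp, psiTwo_π_zero, Preadditive.comp_nsmul, phiTwo_π,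
      biprodIsoTwelvefold_hom_π_zero_assoc, biprodIsoTwelvefold_hom_π_one_assoc, biprod.lift_fst,
      biprod.map_fst, biprod.map_snd]
  · simp only [Category.assoc, biprodIsoTwelvefold_hom_π_one, etaTwo, etaBiprod, Preadditive.add_comp,
      Preadditive.comp_add, Category.id_comp, psiTwo_π_one, phiTwo_π,
      biprodIsoTwelvefold_hom_π_zero_assoc, biprodIsoTwelvefold_hom_π_one_assoc, biprod.lift_snd,
      biprod.map_fst, biprod.map_snd]

end Summit.HodgeConjecture.HodgeConjecture.BiquadraticSecantLift
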